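import Literature.Computability.AlgebraicComplexity.FlipGraphOrbitFlips
import Literature.Computability.AlgebraicComplexity.FlipGraphEquivariance
import HarnessLib

/-!
# The cyclic symmetry `C₃` of `⟨n,n,n⟩`-schemes (Moosbauer–Poole 2025, §2)

Topic `Literature/Computability/AlgebraicComplexity`; companion of `FlipGraphSymmetry.lean` (the cyclic
shift `Symmetry.cycleSq n`: KM's "replace every `A⊗B⊗Γ` by `B⊗Γ⊗A`"), `FlipGraphEquivariance.lean`
(KM's group `G`, `InSymmetryGroup`) and `FlipGraphOrbitFlips.lean` (MP Thm. 4 for a finite group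
acting by symmetries). Source: J. Moosbauer, M. Poole, *Flip Graphs with Symmetry and New Matrix
Multiplication Schemes*, ISSAC 2025 = arXiv:2502.04514 (MP), §2: "The group `S₃` acts by permuting
the three factors and transposing them if the permutation is odd. … In the present paper we consider
two subgroups of the symmetry group. All decompositions will be invariant under the action of
`C₃ ≤ S₃` that cyclically permutes the factors." and Def. 2 (`G`-invariant schemes); §3–§4 use
`G = C₃` (and `C₃ × ℤ₂`). Everything here is PROVED; no named facts.

## Contents

* `Symmetry.pow φ k` — powers of a symmetry (`φ⁰ = id`, `φ^{k+1} = φ^k` then `φ`), `Symmetry.pow_apply`.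
* `cycRep n : Multiplicative (ZMod 3) → Symmetry ⟨n,n,n⟩` — **the subgroup `C₃`** generated by the
  cyclic shift, `g = ρ^k ↦ (cycleSq n)^k`; every `cycRep n g` lies in KM's group `G`
  (`inSymmetryGroup_cycRep`); `cycleMap_iterate_three` — `ρ³ = id`.
* `cycAction n` — the action of `C₃` on the tensor space `(K^{n×n})^{⊗3}` BY these symmetries
  (`DistribMulAction.ofSymmetries`; `g • T = ρ^k T`), so that `FlipGraphOrbitFlips.lean` (MP Thm. 4)
  applies with `ρ = cycRep n`, `hρ = fun _ _ => rfl` (`cycRep_smul`). It is a `def`, to be enabled with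
  `attribute [local instance] cycAction`.
* `isInvariantUnder_cyc_iff` — **a scheme is `C₃`-invariant (MP Def. 2) iff it is mapped to itself by
  the cyclic shift**; `card_orbitFinset_cyc` — every `C₃`-orbit has `1` or `3` elements, and
  `card_orbitFinset_cyc_eq_three_iff` — **"orbits of size `|G|`"**: the orbit of `T` has `3` elements
  iff `ρ T ≠ T`.
* §3 **MP Def. 6 / Lemma 7 for `n = 3`, `G = C₃`, diagonal partition `{{1,2},{3}}`** (MP §5: "For
  `n = 3` we can match the upper bound `23` with `G = C₃` and any diagonal partition into two parts"):
  the starting point `S ∪ T` over `ℤ₂` as a scheme `start` of `⟨3,3,3⟩` of rank `32`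
  (`T` = the cubes `(e₁₁+e₂₂)^{⊗3}`, `e₃₃^{⊗3}`; `S` = the `30` standard basis elements of `M₃ − Σ T`),
  `start_invariant` (Lemma 7 (i): `C₃`-invariant), `card_orbitFinset_startS` (Lemma 7 (ii): every
  element of `S` has an orbit of size `3`), `card_orbitFinset_startT` (the cubes are fixed).

## References

* J. Moosbauer, M. Poole, *Flip Graphs with Symmetry and New Matrix Multiplication Schemes*,
  ISSAC 2025, doi:10.1145/3747199.3747566, arXiv:2502.04514, §2 (the action of `S₃`, `C₃`; Def. 2),
  Thm. 4 ("orbits of size `|G|`"), §4 Def. 6 and Lemma 7 (starting points), §5 (`n = 3`, `G = C₃`).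
  [MoosbauerPoole2025]
* M. Kauers, J. Moosbauer, *Flip Graphs for Matrix Multiplication*, ISSAC 2023, arXiv:2212.01175, §2
  ("replace every `A⊗B⊗Γ` by `B⊗Γ⊗A`"). [KauersMoosbauer2022FlipGraphs]
-/

namespace Literature.Computability.AlgebraicComplexity

open scoped BigOperators
open Multiset

namespace FlipGraph

/-! ## §1 Powers of a symmetry -/

section Pow

variable {K : Type*} [Field K] {ι κ μ : Type*} {t : ι → κ → μ → K}

/-- Powers of a symmetry of `t`: `φ⁰ = id`, `φ^{k+1} = φ ∘ φ^k`.
[cite: KauersMoosbauer2022FlipGraphs, §2 (the symmetry group: composites of the generators)] -/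
def Symmetry.pow (φ : Symmetry t) : ℕ → Symmetry t
  | 0 => Symmetry.refl t
  | k + 1 => (Symmetry.pow φ k).trans φ

/-- `φ^k` acts as the `k`-fold iterate of `φ`. [cite: KauersMoosbauer2022FlipGraphs, §2] -/
theorem Symmetry.pow_apply (φ : Symmetry t) (k : ℕ) (T : ι → κ → μ → K) :
    (φ.pow k).toLinearEquiv T = (φ.toLinearEquiv)^[k] T := by
  induction k generalizing T with
  | zero => rfl
  | succ k ih =>
    rw [Function.iterate_succ_apply', ← ih]
    rfl

end Pow

/-! ## §2 The cyclic group `C₃` of `⟨n,n,n⟩` generated by the cyclic shift -/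

section Cyclic

variable {K : Type*} [Field K] {n : ℕ}

omit [Field K] in
/-- **`ρ³ = id`**: shifting the factors cyclically three times is the identity
(`A⊗B⊗Γ ↦ B⊗Γ⊗A ↦ Γ⊗A⊗B ↦ A⊗B⊗Γ`). [cite: MoosbauerPoole2025, §2 (`C₃ ≤ S₃`)] -/
theorem cycleMap_iterate_three
    (T : (Fin n × Fin n) → (Fin n × Fin n) → (Fin n × Fin n) → K) : (cycleMap n)^[3] T = T := by
  funext a b c
  simp only [Function.iterate_succ, Function.iterate_zero, Function.comp_apply, id_eq, cycleMap,
    Prod.swap_swap]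

omit [Field K] in
/-- Iterates of the cyclic shift only depend on the exponent mod `3`.
[cite: MoosbauerPoole2025, §2 (`C₃ ≤ S₃`)] -/
theorem cycleMap_iterate_mod (m : ℕ)
    (T : (Fin n × Fin n) → (Fin n × Fin n) → (Fin n × Fin n) → K) :
    (cycleMap n)^[m] T = (cycleMap n)^[m % 3] T := by
  conv_lhs => rw [← Nat.mod_add_div m 3, Function.iterate_add_apply, Function.iterate_mul]
  rw [Function.iterate_fixed (cycleMap_iterate_three T)]

/-- **The subgroup `C₃` of the symmetry group of `⟨n,n,n⟩`** "that cyclically permutes the factors":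
the element `ρ^k` (`k ∈ ℤ/3`) acts as the `k`-th power of the cyclic shift `cycleSq n`.
[cite: MoosbauerPoole2025, §2 ("the action of `C₃ ≤ S₃` that cyclically permutes the factors")] -/
def cycRep (n : ℕ) (g : Multiplicative (ZMod 3)) : Symmetry (matMulTensor K n n n) :=
  (Symmetry.cycleSq n).pow (Multiplicative.toAdd g).val

/-- `ρ^k` acts as the `k`-fold cyclic shift. [cite: MoosbauerPoole2025, §2] -/
theorem cycRep_apply (g : Multiplicative (ZMod 3))
    (T : (Fin n × Fin n) → (Fin n × Fin n) → (Fin n × Fin n) → K) :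
    (cycRep (K := K) n g).toLinearEquiv T = (cycleMap n)^[(Multiplicative.toAdd g).val] T :=
  Symmetry.pow_apply _ _ T

/-- Every element of `C₃` lies in KM's symmetry group `G` (generated by sandwiches, transposition and
the cyclic shift). [cite: KauersMoosbauer2022FlipGraphs, §2 (the symmetry group)] -/
theorem inSymmetryGroup_cycRep (g : Multiplicative (ZMod 3)) :
    InSymmetryGroup (cycRep (K := K) n g) := by
  unfold cycRep
  induction (Multiplicative.toAdd g).val with
  | zero => exact InSymmetryGroup.refl
  | succ k ih => exact InSymmetryGroup.trans ih InSymmetryGroup.cycle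

/-- **The action of `C₃` on the tensor space by these symmetries** (`g • T = (cycRep n g) T`; a
`def` — enable with `attribute [local instance] cycAction`).
[cite: MoosbauerPoole2025, §2 ("the action of `C₃ ≤ S₃`")] -/
@[reducible] def cycAction (n : ℕ) :
    DistribMulAction (Multiplicative (ZMod 3))
      ((Fin n × Fin n) → (Fin n × Fin n) → (Fin n × Fin n) → K) :=
  DistribMulAction.ofSymmetries (cycRep n)
    (fun T => by
      rw [cycRep_apply]
      rfl)
    (fun g h T => by
      rw [cycRep_apply, cycRep_apply, cycRep_apply, ← Function.iterate_add_apply, toAdd_mul,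
        ZMod.val_add, ← cycleMap_iterate_mod])

attribute [local instance] cycAction

/-- With this action, `(cycRep n g) T = g • T` holds by definition: the hypothesis `hρ` of
`FlipGraphOrbitFlips.lean` (MP Thm. 4) for `G = C₃`. [cite: MoosbauerPoole2025, §2 and Thm. 4] -/
theorem cycRep_smul (g : Multiplicative (ZMod 3))
    (T : (Fin n × Fin n) → (Fin n × Fin n) → (Fin n × Fin n) → K) :
    (cycRep (K := K) n g).toLinearEquiv T = g • T :=
  rfl

/-- The generator acts as the cyclic shift: `ρ • T = cycleMap n T`. [cite: MoosbauerPoole2025, §2] -/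
theorem ofAdd_one_smul (T : (Fin n × Fin n) → (Fin n × Fin n) → (Fin n × Fin n) → K) :
    Multiplicative.ofAdd (1 : ZMod 3) • T = cycleMap n T := by
  show (cycRep (K := K) n _).toLinearEquiv T = _
  rw [cycRep_apply]
  rfl

/-- **MP Def. 2 for `G = C₃`: a scheme of `⟨n,n,n⟩` is `C₃`-invariant iff the cyclic shift maps it to
itself** (invariance under the generator). [cite: MoosbauerPoole2025, Def. 2 with §2 (`C₃`)] -/
theorem isInvariantUnder_cyc_iff (S : Scheme (matMulTensor K n n n)) :
    IsInvariantUnder (Set.range (cycRep (K := K) n)) S ↔ S.map (Symmetry.cycleSq n) = S := by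
  constructor
  · intro h
    have e := h (cycRep n (Multiplicative.ofAdd 1)) ⟨_, rfl⟩
    have hrep : cycRep (K := K) n (Multiplicative.ofAdd 1) = (Symmetry.cycleSq n).pow 1 := by
      unfold cycRep
      congr 1
    rw [hrep] at e
    -- `φ.pow 1 = refl.trans φ` acts as `φ`
    have : S.map ((Symmetry.cycleSq n).pow 1) = S.map (Symmetry.cycleSq n) := by
      show S.map ((Symmetry.refl _).trans (Symmetry.cycleSq n)) = _
      rw [Scheme.map_trans, Scheme.map_refl]
    rwa [this] at e
  · rintro h φ ⟨g, rfl⟩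
    unfold cycRep
    induction (Multiplicative.toAdd g).val with
    | zero => exact Scheme.map_refl S
    | succ k ih =>
      show S.map (((Symmetry.cycleSq n).pow k).trans (Symmetry.cycleSq n)) = S
      rw [Scheme.map_trans, ih, h]

/-- `|C₃| = 3`. [folklore] -/
private theorem card_C3 : Fintype.card (Multiplicative (ZMod 3)) = 3 := by
  rw [Fintype.card_multiplicative, ZMod.card]

variable [DecidableEq K]

/-- Every `C₃`-orbit has `1` or `3` elements. [cite: MoosbauerPoole2025, Thm. 4 (proof:
orbit-stabilizer; "orbits of size `|G|`")] -/
theorem card_orbitFinset_cyc (T : (Fin n × Fin n) → (Fin n × Fin n) → (Fin n × Fin n) → K) :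
    (orbitFinset (Multiplicative (ZMod 3)) T).card = 1 ∨
      (orbitFinset (Multiplicative (ZMod 3)) T).card = 3 := by
  have h := card_orbitFinset_dvd (G := Multiplicative (ZMod 3)) T
  rw [card_C3] at h
  rcases (Nat.dvd_prime Nat.prime_three).mp h with h | h
  · exact Or.inl h
  · exact Or.inr h

/-- **"orbits of size `|G|`" for `G = C₃`:** the orbit of `T` has `3` elements iff the cyclic shift
moves `T` (`ρ T ≠ T`); otherwise `T` is `C₃`-invariant and its orbit is `{T}`.
[cite: MoosbauerPoole2025, Thm. 4 (hypothesis "with orbits of size `|G|`") with §2 (`C₃`)] -/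
theorem card_orbitFinset_cyc_eq_three_iff
    (T : (Fin n × Fin n) → (Fin n × Fin n) → (Fin n × Fin n) → K) :
    (orbitFinset (Multiplicative (ZMod 3)) T).card = 3 ↔ cycleMap n T ≠ T := by
  have e : (orbitFinset (Multiplicative (ZMod 3)) T).card =
      Fintype.card (Multiplicative (ZMod 3)) ↔
        (orbitFinset (Multiplicative (ZMod 3)) T).card = 3 := by
    rw [card_C3]
  rw [← e, card_orbitFinset_eq_card_iff, stabCard_eq_one_iff]
  constructor
  · intro h hT
    have h1 := h (Multiplicative.ofAdd 1) (by rw [ofAdd_one_smul, hT])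
    exact absurd (congrArg Multiplicative.toAdd h1) (by decide)
  · intro hT g hg
    -- `g = ρ^k`, `k ∈ {0,1,2}`; `ρ T = T` is excluded, and `ρ² T = T` forces `ρ T = ρ³ T = T`
    have hk : ∀ k : ZMod 3, (cycleMap n)^[k.val] T = T → k = 0 := by
      intro k hk
      fin_cases k
      · rfl
      · exact absurd hk hT
      · exfalso
        apply hT
        have e : (cycleMap n)^[3] T = cycleMap n T := by
          show cycleMap n ((cycleMap n)^[2] T) = _
          exact congrArg (cycleMap n) hk
        rw [cycleMap_iterate_three] at e
        exact e.symm
    have := hk (Multiplicative.toAdd g) (by rw [← cycRep_apply, cycRep_smul]; exact hg)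
    exact toAdd_eq_zero.mp this

end Cyclic

/-! ## §3 The `C₃`-invariant starting point for `⟨3,3,3⟩` (MP Def. 6 / Lemma 7, `n = 3`) -/

section Start

/-! MP Def. 6: "Let `G = C₃` … Let `𝒫` be a partition of `{1,…,n}` … Let
`T = {(Σ_{i∈P} a_{ii}) ⊗ (Σ_{i∈P} b_{ii}) ⊗ (Σ_{i∈P} c_{ii}) | P ∈ 𝒫}`. Let `S` be the decomposition of
`M_n − Σ_{t∈T} t` into standard basis elements. Then we call `S ∪ T` the starting point for the diagonal
partition `𝒫`." Here: `n = 3`, `K = ℤ₂`, `𝒫 = {{1,2},{3}}` ("For `n = 3` we can match the upper bound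
`23` with `G = C₃` and any diagonal partition into two parts", MP §5). Over `ℤ₂`,
`M₃ − Σ T = M₃ + (e₁₁+e₂₂)^{⊗3} + e₃₃^{⊗3}` consists of the `24` standard basis elements
`e_{κν} ⊗ e_{κμ} ⊗ e_{μν}` of `M₃` with `(κ,μ,ν)` not constant (the three constant ones cancel) and the
`6` mixed products `e_{pp} ⊗ e_{qq} ⊗ e_{rr}`, `p,q,r ∈ {1,2}` not all equal. -/

/-- The matrix unit `e_p ∈ ℤ₂^{3×3}` as a coordinate vector. [folklore] -/
private def unitVec (p : Fin 3 × Fin 3) : Fin 3 × Fin 3 → ZMod 2 := fun q => if q = p then 1 else 0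

/-- Index set of `S`: the non-constant triples `(κ,μ,ν) ∈ {1,2,3}³` (standard basis elements of `M₃`)
and the non-constant triples `(p,q,r) ∈ {1,2}³` (mixed products of the cube `(e₁₁+e₂₂)^{⊗3}`).
[cite: MoosbauerPoole2025, Def. 6 (the set `S`)] -/
abbrev StartIndex : Type :=
  {x : Fin 3 × Fin 3 × Fin 3 // ¬ (x.1 = x.2.1 ∧ x.2.1 = x.2.2)} ⊕
    {x : Fin 2 × Fin 2 × Fin 2 // ¬ (x.1 = x.2.1 ∧ x.2.1 = x.2.2)}

/-- The elements of `S` (tree slots `(Z, X, Y)` = positions `(κ,ν), (κ,μ), (μ,ν)`):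
`e_{κν} ⊗ e_{κμ} ⊗ e_{μν}` and `e_{pp} ⊗ e_{qq} ⊗ e_{rr}`.
[cite: MoosbauerPoole2025, Def. 6 (the set `S`)] -/
def startS : StartIndex → (Fin 3 × Fin 3) → (Fin 3 × Fin 3) → (Fin 3 × Fin 3) → ZMod 2
  | Sum.inl ⟨(κ, μ, ν), _⟩ => triad (unitVec (κ, ν)) (unitVec (κ, μ)) (unitVec (μ, ν))
  | Sum.inr ⟨(p, q, r), _⟩ =>
      triad (unitVec (p.castSucc, p.castSucc)) (unitVec (q.castSucc, q.castSucc))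
        (unitVec (r.castSucc, r.castSucc))

/-- The diagonal matrices `e₁₁ + e₂₂` and `e₃₃` of the partition `{{1,2},{3}}`. [folklore] -/
private def diagVec (i : Fin 2) : Fin 3 × Fin 3 → ZMod 2 :=
  fun q => if q.1 = q.2 ∧ ((i = 0 ∧ q.1 ≠ 2) ∨ (i = 1 ∧ q.1 = 2)) then 1 else 0

/-- The elements of `T`: the two `C₃`-invariant cubes `(a₁₁+a₂₂)⊗(b₁₁+b₂₂)⊗(c₁₁+c₂₂)` and
`a₃₃⊗b₃₃⊗c₃₃`. [cite: MoosbauerPoole2025, Def. 6 (the set `T`)] -/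
def startT (i : Fin 2) : (Fin 3 × Fin 3) → (Fin 3 × Fin 3) → (Fin 3 × Fin 3) → ZMod 2 :=
  triad (diagVec i) (diagVec i) (diagVec i)

/-- `Σ S + Σ T = M₃` over `ℤ₂` (`S` "the decomposition of `M_n − Σ_{t∈T} t` into standard basis
elements"; kernel evaluation of the `729` entries). [cite: MoosbauerPoole2025, Def. 6] -/
theorem sum_startS_add_sum_startT :
    ∑ s, startS s + ∑ i, startT i = matMulTensor (ZMod 2) 3 3 3 := by
  funext a b c
  simp only [Pi.add_apply, Finset.sum_apply]
  revert a b c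
  decide +kernel

/-- The elements of `S` and `T` are non-zero. [cite: MoosbauerPoole2025, Def. 6 with KM Def. 1] -/
theorem startS_ne_zero : (∀ s, startS s ≠ 0) ∧ ∀ i, startT i ≠ 0 := by
  constructor <;> decide +kernel

/-- Two `Scheme`s with the same elements are equal (bookkeeping). [folklore] -/
private theorem scheme_ext₃ {K : Type*} [Field K] {ι κ μ : Type*} {t : ι → κ → μ → K}
    {x y : Scheme t} (h : x.elts = y.elts) : x = y := by
  cases x; cases y; cases h; rfl

/-- **The starting point `S ∪ T` for `⟨3,3,3⟩`, `G = C₃`, diagonal partition `{{1,2},{3}}`** as a scheme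
of `⟨3,3,3⟩` over `ℤ₂` (rank `32`). [cite: MoosbauerPoole2025, Def. 6] -/
def start : Scheme (matMulTensor (ZMod 2) 3 3 3) where
  elts :=
    (Finset.univ : Finset StartIndex).val.map startS + (Finset.univ : Finset (Fin 2)).val.map startT
  ne_zero T hT := by
    rcases Multiset.mem_add.mp hT with hT | hT
    · obtain ⟨s, -, rfl⟩ := Multiset.mem_map.mp hT
      exact startS_ne_zero.1 s
    · obtain ⟨i, -, rfl⟩ := Multiset.mem_map.mp hT
      exact startS_ne_zero.2 i
  exists_triad T hT := by
    rcases Multiset.mem_add.mp hT with hT | hT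
    · obtain ⟨s, -, rfl⟩ := Multiset.mem_map.mp hT
      rcases s with ⟨⟨κ, μ, ν⟩, _⟩ | ⟨⟨p, q, r⟩, _⟩
      · exact ⟨_, _, _, rfl⟩
      · exact ⟨_, _, _, rfl⟩
    · obtain ⟨i, -, rfl⟩ := Multiset.mem_map.mp hT
      exact ⟨_, _, _, rfl⟩
  sum_eq := by
    rw [Multiset.sum_add]
    exact sum_startS_add_sum_startT

/-- Its rank is `24 + 6 + 2 = 32`. [cite: MoosbauerPoole2025, Def. 6] -/
theorem rank_start : start.rank = 32 := by
  rw [Scheme.rank, start, Multiset.card_add, Multiset.card_map, Multiset.card_map, Finset.card_val,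
    Finset.card_val, Finset.card_univ, Finset.card_univ]
  rfl

/-- The rotation `(κ,μ,ν) ↦ (μ,ν,κ)`, `(p,q,r) ↦ (q,r,p)` of the index triples. [folklore] -/
private def rot : StartIndex → StartIndex
  | Sum.inl ⟨(κ, μ, ν), h⟩ => Sum.inl ⟨(μ, ν, κ), fun h' => h ⟨(h'.1.trans h'.2).symm, h'.1⟩⟩
  | Sum.inr ⟨(p, q, r), h⟩ => Sum.inr ⟨(q, r, p), fun h' => h ⟨(h'.1.trans h'.2).symm, h'.1⟩⟩

/-- The rotation of index triples as a permutation (its inverse is rotating twice). [folklore] -/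
private def rotEquiv : StartIndex ≃ StartIndex where
  toFun := rot
  invFun := rot ∘ rot
  left_inv x := by rcases x with ⟨⟨κ, μ, ν⟩, h⟩ | ⟨⟨p, q, r⟩, h⟩ <;> rfl
  right_inv x := by rcases x with ⟨⟨κ, μ, ν⟩, h⟩ | ⟨⟨p, q, r⟩, h⟩ <;> rfl

/-- The cyclic shift `A⊗B⊗Γ ↦ B⊗Γ⊗A` permutes the elements of `S` (rotating their index triples; in
particular it moves every one of them) and fixes the two cubes of `T` (kernel evaluation).
[cite: MoosbauerPoole2025, Lemma 7 (proof)] -/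
theorem cycleMap_start :
    (∀ s : StartIndex, cycleMap 3 (startS s) = startS (rot s)) ∧
      (∀ s : StartIndex, cycleMap 3 (startS s) ≠ startS s) ∧
      ∀ i, cycleMap 3 (startT i) = startT i := by
  refine ⟨?_, ?_, ?_⟩ <;> decide +kernel

/-- The cyclic shift maps the starting point to itself. [cite: MoosbauerPoole2025, Lemma 7
("`S ∪ T` is a `G`-invariant matrix multiplication scheme")] -/
theorem start_map_cycleSq : start.map (Symmetry.cycleSq 3) = start := by
  apply scheme_ext₃
  rw [Scheme.map_elts]
  show Multiset.map (cycleMap 3) start.elts = start.elts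
  simp only [start, Multiset.map_add, Multiset.map_map]
  congr 1
  · have h : cycleMap 3 ∘ startS = startS ∘ rotEquiv := funext fun s => cycleMap_start.1 s
    rw [h, ← Multiset.map_map, Multiset.map_univ_val_equiv]
  · have h : cycleMap 3 ∘ startT = startT := funext fun i => cycleMap_start.2.2 i
    rw [h]

/-- **MP Lemma 7 for `n = 3`, `G = C₃`, `𝒫 = {{1,2},{3}}` — (i): the starting point `S ∪ T` is a
`C₃`-invariant matrix multiplication scheme.** [cite: MoosbauerPoole2025, Lemma 7] -/
theorem start_invariant : IsInvariantUnder (Set.range (cycRep (K := ZMod 2) 3)) start :=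
  (isInvariantUnder_cyc_iff start).mpr start_map_cycleSq

attribute [local instance] cycAction

/-- **MP Lemma 7 — (ii): "the orbit of every element in `S` has size `|G|`"** (`= 3`).
[cite: MoosbauerPoole2025, Lemma 7] -/
theorem card_orbitFinset_startS (s : StartIndex) :
    (orbitFinset (Multiplicative (ZMod 3)) (startS s)).card = 3 :=
  (card_orbitFinset_cyc_eq_three_iff _).mpr (cycleMap_start.2.1 s)

/-- … while the two cubes of `T` are `C₃`-invariant: their orbits are singletons.
[cite: MoosbauerPoole2025, Lemma 7 (proof: "`T` is `G`-invariant by construction")] -/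
theorem card_orbitFinset_startT (i : Fin 2) :
    (orbitFinset (Multiplicative (ZMod 3)) (startT i)).card = 1 := by
  rcases card_orbitFinset_cyc (K := ZMod 2) (startT i) with h | h
  · exact h
  · exact absurd ((card_orbitFinset_cyc_eq_three_iff _).mp h) (not_not.mpr (cycleMap_start.2.2 i))

end Start

end FlipGraph

end Literature.Computability.AlgebraicComplexity
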